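import Literature.NumberTheory.Sieve.FriedlanderIwaniecPrimesVaughanEngine
import Literature.NumberTheory.Sieve.ParityBarrierProofs
import HarnessLib

/-!
# `TypeIIToLevel` (route `LiouvilleMAD`), part 1: a real Vaughan engine with budget hypotheses

Support file for the item stmt-Parity-14996
(`Summit.Parity.GeneralizedHardyLittlewood.Theses.LiouvilleMAD.TypeIIToLevel`,
`TypeIILiouville → LambdaLiouvilleLevel`).

For a real sequence `lam` with `|lam| ≤ 1` we bound `∑_{n ≤ x} Λ(n) lam(n)` by Vaughan's identity
`Λ = Λ_{≤U} + μ_{≤U} * log − c_U * ζ + F_U * G_U` (tree: `Vaughan.vonMangoldt_eq_four_terms`) from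

* a **Type-I budget** (hypothesis `hI`): `|∑_{m ≤ t} lam(dm)| ≤ F d` for `d ≤ U²`, `t ≤ x/d`
  (no saving is asked pointwise — the budget `∑_d F d` is what the consumer controls, on average over a
  family of sequences, by Bombieri–Vinogradov for `λ`);
* a **Type-II hypothesis** (`hII`) on rectangles `(D₁, D₂] × (0, N]` with `U ≤ D₁ ≤ D₂ ≤ 2D₁`,
  `U/2 ≤ N`: `|∑∑ a(d) b(m) lam(dm)| ≤ A B W D₁ N` for `|a| ≤ A`, `|b| ≤ B` (the saving is inside `W`).

This part: Dirichlet's rearrangement, Abel summation, the trivial piece `Λ_{≤U}`, the two type-I pieces,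
and the separation of `dm ≤ x` on one short interval of `d` (the "cruder but sufficient" method of
Friedlander–Iwaniec, §26 of *The polynomial X² + Y⁴ captures its primes*; tree template
`Literature/NumberTheory/Sieve/FriedlanderIwaniecPrimesVaughanEngine.lean`, here transposed from `ℂ` with
power-saving pointwise hypotheses to `ℝ` with budgets).
-/

noncomputable section

open Finset Real
open ArithmeticFunction
open scoped ArithmeticFunction.Moebius ArithmeticFunction.zeta ArithmeticFunction.sigma
  ArithmeticFunction.vonMangoldt

namespace Summit.Parity.GeneralizedHardyLittlewood.Theorems.TypeIIToLevel

open Literature.NumberTheory.Sieve.Vaughan (cU gU fU arith_sub_apply sum_Ioc_sum_divisorsAntidiagonal_eq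
  log_eq_sum_Ioc_sub log_sub_log_pred_nonneg abs_cU_le_log cU_eq_zero_of_lt vonMangoldt_eq_four_terms)
open Literature.NumberTheory.Sieve (moebiusTrunc vonMangoldtTrunc moebiusTrunc_apply vonMangoldtTrunc_apply)

/-! ### The hypotheses of the engine

Both hypotheses are carried INLINE (no definitions in this file):

* Type-I budget `hI : ∀ d t, 1 ≤ d → d ≤ U·U → t ≤ x/d → |∑_{m ≤ t} lam(dm)| ≤ F d`;
* Type-II on rectangles `hII : ∀ D₁ D₂ N, U ≤ D₁ → D₁ ≤ D₂ → D₂ ≤ 2D₁ → U/2 ≤ N → ∀ A B ≥ 0, ∀ a b`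
  with `|a| ≤ A` on `(D₁, D₂]`, `|b| ≤ B` on `(0, N]`:
  `|∑_{D₁ < d ≤ D₂} a(d) ∑_{m ≤ N} b(m) lam(dm)| ≤ A B W D₁ N` (the saving lives in `W`).
-/

/-! ### Abel summation with logarithmic weights -/

/-- **Abel summation**: if all partial sums `∑_{m ≤ t} a_m`, `t ≤ X`, are bounded by `F` in absolute
value, then `|∑_{m ≤ X} (log m) a_m| ≤ 2 F log X`. [folklore] -/
theorem abs_sum_log_mul_le (a : ℕ → ℝ) (X : ℕ) {F : ℝ}
    (hF : ∀ t, t ≤ X → |∑ m ∈ Ioc 0 t, a m| ≤ F) :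
    |∑ m ∈ Ioc 0 X, Real.log m * a m| ≤ 2 * F * Real.log X := by
  set w : ℕ → ℝ := fun j => Real.log j - Real.log (j - 1 : ℕ) with hw
  have hw0 : ∀ j, 0 ≤ w j := fun j => log_sub_log_pred_nonneg j
  have hlog : ∀ m ∈ Ioc 0 X, Real.log m = ∑ j ∈ Ioc 0 X, if j ≤ m then w j else 0 := by
    intro m hm
    rw [mem_Ioc] at hm
    rw [log_eq_sum_Ioc_sub m, ← sum_filter]
    refine sum_congr ?_ fun j _ => rfl
    ext j; simp only [mem_Ioc, mem_filter]; omega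
  have hswap : ∑ m ∈ Ioc 0 X, Real.log m * a m =
      ∑ j ∈ Ioc 0 X, w j * (∑ m ∈ Ioc 0 X, a m - ∑ m ∈ Ioc 0 (j - 1), a m) := by
    rw [sum_congr rfl fun m hm => by rw [hlog m hm, sum_mul], sum_comm]
    refine sum_congr rfl fun j hj => ?_
    rw [mem_Ioc] at hj
    have hsplit := sum_Ioc_consecutive a (Nat.zero_le (j - 1)) (by omega : j - 1 ≤ X)
    rw [← hsplit, add_sub_cancel_left, mul_sum]
    simp_rw [ite_mul, zero_mul]
    rw [← sum_filter]
    refine sum_congr ?_ fun m _ => rfl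
    ext m; simp only [mem_filter, mem_Ioc]; omega
  rw [hswap]
  calc |∑ j ∈ Ioc 0 X, w j * (∑ m ∈ Ioc 0 X, a m - ∑ m ∈ Ioc 0 (j - 1), a m)|
      ≤ ∑ j ∈ Ioc 0 X, w j * (2 * F) := by
        refine (abs_sum_le_sum_abs _ _).trans (sum_le_sum fun j hj => ?_)
        rw [mem_Ioc] at hj
        rw [abs_mul, abs_of_nonneg (hw0 j)]
        refine mul_le_mul_of_nonneg_left ?_ (hw0 j)
        calc |∑ m ∈ Ioc 0 X, a m - ∑ m ∈ Ioc 0 (j - 1), a m|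
            ≤ |∑ m ∈ Ioc 0 X, a m| + |∑ m ∈ Ioc 0 (j - 1), a m| := abs_sub _ _
          _ ≤ F + F := add_le_add (hF X le_rfl) (hF (j - 1) (by omega))
          _ = 2 * F := by ring
    _ = 2 * F * Real.log X := by
        rw [← sum_mul, show ∑ j ∈ Ioc 0 X, w j = Real.log X from (log_eq_sum_Ioc_sub X).symm]; ring

/-! ### The trivial piece `Λ_{≤U}` -/

/-- **The short piece** of Vaughan's identity: `|∑_{n ≤ x} Λ_{≤U}(n) lam(n)| ≤ U log U` for `|lam| ≤ 1`.
[folklore] -/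
theorem abs_sum_vonMangoldtTrunc_mul_le {lam : ℕ → ℝ} (hlam : ∀ n, |lam n| ≤ 1) (x U : ℕ) :
    |∑ n ∈ Ioc 0 x, vonMangoldtTrunc U n * lam n| ≤ U * Real.log U := by
  have hsplit : ∑ n ∈ Ioc 0 x, vonMangoldtTrunc U n * lam n =
      ∑ n ∈ (Ioc 0 x).filter (· ≤ U), vonMangoldtTrunc U n * lam n := by
    rw [sum_filter]
    refine sum_congr rfl fun n _ => ?_
    split_ifs with h
    · rfl
    · rw [vonMangoldtTrunc_apply, if_neg h]; simp
  rw [hsplit]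
  have hsub : (Ioc 0 x).filter (· ≤ U) ⊆ Ioc 0 U := by
    intro d hd; rw [mem_filter, mem_Ioc] at hd; rw [mem_Ioc]; exact ⟨hd.1.1, hd.2⟩
  have hlogU : 0 ≤ Real.log U := Real.log_natCast_nonneg U
  calc |∑ n ∈ (Ioc 0 x).filter (· ≤ U), vonMangoldtTrunc U n * lam n|
      ≤ ∑ n ∈ (Ioc 0 x).filter (· ≤ U), Real.log U * 1 := by
        refine (abs_sum_le_sum_abs _ _).trans (sum_le_sum fun n hn => ?_)
        rw [mem_filter, mem_Ioc] at hn
        have hn0 : (0 : ℝ) < n := by exact_mod_cast hn.1.1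
        rw [abs_mul, vonMangoldtTrunc_apply, if_pos hn.2, abs_of_nonneg vonMangoldt_nonneg]
        refine mul_le_mul ?_ (hlam n) (abs_nonneg _) hlogU
        exact vonMangoldt_le_log.trans (Real.log_le_log hn0 (by exact_mod_cast hn.2))
    _ ≤ ∑ n ∈ Ioc 0 U, Real.log U * 1 :=
        sum_le_sum_of_subset_of_nonneg hsub fun n _ _ => by positivity
    _ = U * Real.log U := by
        rw [sum_const, Nat.card_Ioc, Nat.sub_zero, nsmul_eq_mul]; ring

/-! ### The type-I pieces -/

section TypeI

variable {lam : ℕ → ℝ} {x U : ℕ} {F : ℕ → ℝ}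

/-- **Type-I piece with the logarithm** (the term `μ_{≤U} * log`):
`|∑_{n ≤ x} (μ_{≤U} * log)(n) lam(n)| ≤ 2 log x · ∑_{d ≤ U} F d`. [folklore] -/
theorem abs_sum_moebiusTrunc_log_mul_le (hI : ∀ d t : ℕ, 1 ≤ d → d ≤ U * U → t ≤ x / d → |∑ m ∈ Ioc 0 t, lam (d * m)| ≤ F d) (hF : ∀ d, 0 ≤ F d) :
    |∑ n ∈ Ioc 0 x, ((moebiusTrunc U : ArithmeticFunction ℝ) * ArithmeticFunction.log) n * lam n| ≤
      2 * Real.log x * ∑ d ∈ Ioc 0 U, F d := by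
  rw [Literature.NumberTheory.Sieve.sum_Ioc_mul_apply_mul_eq_sum_sum]
  have hlogx : 0 ≤ Real.log x := Real.log_natCast_nonneg x
  -- only `d ≤ U` contribute
  have hsplit : ∑ d ∈ Ioc 0 x, (moebiusTrunc U : ArithmeticFunction ℝ) d *
      ∑ m ∈ Ioc 0 (x / d), ArithmeticFunction.log m * lam (d * m) =
      ∑ d ∈ (Ioc 0 x).filter (· ≤ U), (moebiusTrunc U : ArithmeticFunction ℝ) d *
        ∑ m ∈ Ioc 0 (x / d), ArithmeticFunction.log m * lam (d * m) := by
    rw [sum_filter]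
    refine sum_congr rfl fun d _ => ?_
    split_ifs with h
    · rfl
    · rw [intCoe_apply, moebiusTrunc_apply, if_neg h]; simp
  rw [hsplit]
  have hsub : (Ioc 0 x).filter (· ≤ U) ⊆ Ioc 0 U := by
    intro d hd; rw [mem_filter, mem_Ioc] at hd; rw [mem_Ioc]; exact ⟨hd.1.1, hd.2⟩
  calc |∑ d ∈ (Ioc 0 x).filter (· ≤ U), (moebiusTrunc U : ArithmeticFunction ℝ) d *
        ∑ m ∈ Ioc 0 (x / d), ArithmeticFunction.log m * lam (d * m)|
      ≤ ∑ d ∈ (Ioc 0 x).filter (· ≤ U), 1 * (2 * F d * Real.log x) := by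
        refine (abs_sum_le_sum_abs _ _).trans (sum_le_sum fun d hd => ?_)
        rw [mem_filter, mem_Ioc] at hd
        have hd1 : 1 ≤ d := hd.1.1
        rw [abs_mul]
        refine mul_le_mul ?_ ?_ (abs_nonneg _) zero_le_one
        · rw [intCoe_apply, moebiusTrunc_apply, if_pos hd.2, ← Int.cast_abs]
          exact_mod_cast abs_moebius_le_one
        · have h := abs_sum_log_mul_le (fun m => lam (d * m)) (x / d) (F := F d)
            fun t ht => hI d t hd1 (hd.2.trans (Nat.le_mul_self U)) ht
          simp only [ArithmeticFunction.log_apply] at h ⊢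
          refine h.trans ?_
          have hlog : Real.log ((x / d : ℕ) : ℝ) ≤ Real.log x := by
            rcases Nat.eq_zero_or_pos (x / d) with h0 | hpos
            · rw [h0, Nat.cast_zero, Real.log_zero]; exact hlogx
            · exact Real.log_le_log (by exact_mod_cast hpos) (by exact_mod_cast Nat.div_le_self x d)
          have h0 : 0 ≤ 2 * F d := by linarith [hF d]
          exact mul_le_mul_of_nonneg_left hlog h0
    _ = 2 * Real.log x * ∑ d ∈ (Ioc 0 x).filter (· ≤ U), F d := by
        rw [mul_sum]; refine sum_congr rfl fun d _ => ?_; ring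
    _ ≤ 2 * Real.log x * ∑ d ∈ Ioc 0 U, F d := by
        refine mul_le_mul_of_nonneg_left ?_ (by positivity)
        exact sum_le_sum_of_subset_of_nonneg hsub fun d _ _ => hF d

/-- **Type-I piece without logarithm** (the term `c_U * ζ`, `c_U(d) = 0` for `d > U²`, `|c_U| ≤ log`):
`|∑_{n ≤ x} (c_U * ζ)(n) lam(n)| ≤ 2 log U · ∑_{d ≤ U²} F d`. [folklore] -/
theorem abs_sum_cU_zeta_mul_le (hI : ∀ d t : ℕ, 1 ≤ d → d ≤ U * U → t ≤ x / d → |∑ m ∈ Ioc 0 t, lam (d * m)| ≤ F d) (hF : ∀ d, 0 ≤ F d) :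
    |∑ n ∈ Ioc 0 x, (cU U * (ζ : ArithmeticFunction ℝ)) n * lam n| ≤
      2 * Real.log U * ∑ d ∈ Ioc 0 (U * U), F d := by
  rw [Literature.NumberTheory.Sieve.sum_Ioc_mul_apply_mul_eq_sum_sum]
  -- the inner sums are `∑_{m ≤ x/d} lam(dm)`
  have hinner : ∀ d ∈ Ioc 0 x, ∑ m ∈ Ioc 0 (x / d), (ζ : ArithmeticFunction ℝ) m * lam (d * m) =
      ∑ m ∈ Ioc 0 (x / d), lam (d * m) := by
    intro d _
    refine sum_congr rfl fun m hm => ?_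
    rw [mem_Ioc] at hm
    rw [natCoe_apply, zeta_apply, if_neg (by omega)]; simp
  rw [sum_congr rfl fun d hd => by rw [hinner d hd]]
  -- only `d ≤ U²` contribute
  have hsplit : ∑ d ∈ Ioc 0 x, cU U d * ∑ m ∈ Ioc 0 (x / d), lam (d * m) =
      ∑ d ∈ (Ioc 0 x).filter (· ≤ U * U), cU U d * ∑ m ∈ Ioc 0 (x / d), lam (d * m) := by
    rw [sum_filter]
    refine sum_congr rfl fun d _ => ?_
    split_ifs with h
    · rfl
    · rw [cU_eq_zero_of_lt (not_le.mp h)]; simp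
  rw [hsplit]
  have hsub : (Ioc 0 x).filter (· ≤ U * U) ⊆ Ioc 0 (U * U) := by
    intro d hd; rw [mem_filter, mem_Ioc] at hd; rw [mem_Ioc]; exact ⟨hd.1.1, hd.2⟩
  have hlogU : 0 ≤ Real.log U := Real.log_natCast_nonneg U
  calc |∑ d ∈ (Ioc 0 x).filter (· ≤ U * U), cU U d * ∑ m ∈ Ioc 0 (x / d), lam (d * m)|
      ≤ ∑ d ∈ (Ioc 0 x).filter (· ≤ U * U), (2 * Real.log U) * F d := by
        refine (abs_sum_le_sum_abs _ _).trans (sum_le_sum fun d hd => ?_)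
        rw [mem_filter, mem_Ioc] at hd
        have hd1 : 1 ≤ d := hd.1.1
        rw [abs_mul]
        refine mul_le_mul ?_ (hI d (x / d) hd1 hd.2 le_rfl) (abs_nonneg _) (by positivity)
        refine (abs_cU_le_log U d).trans ?_
        have hd0 : (0 : ℝ) < d := by exact_mod_cast hd1
        calc Real.log d ≤ Real.log ((U * U : ℕ) : ℝ) := Real.log_le_log hd0 (by exact_mod_cast hd.2)
          _ = 2 * Real.log U := by
              have hU0 : (U : ℝ) ≠ 0 := by
                exact_mod_cast (show U ≠ 0 by rintro rfl; simp at hd; omega)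
              push_cast
              rw [Real.log_mul hU0 hU0]; ring
    _ = 2 * Real.log U * ∑ d ∈ (Ioc 0 x).filter (· ≤ U * U), F d := by
        rw [mul_sum]
    _ ≤ 2 * Real.log U * ∑ d ∈ Ioc 0 (U * U), F d := by
        refine mul_le_mul_of_nonneg_left ?_ (by positivity)
        exact sum_le_sum_of_subset_of_nonneg hsub fun d _ _ => hF d

end TypeI

/-! ### One short interval of `d`: rectangle plus boundary -/

section TypeII

variable {lam : ℕ → ℝ} {U : ℕ} {W : ℝ}

/-- **Separation on a short interval** `d ∈ (D₁, D₂]` (`U ≤ D₁ ≤ D₂ ≤ 2D₁ ≤ x`... and `U/2 ≤ x/D₂`): with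
`N₂ = ⌊x/D₂⌋`, `∑_{D₁ < d ≤ D₂} a(d) ∑_{m ≤ x/d} b(m) lam(dm)` is the bilinear form on the rectangle
`(D₁, D₂] × [1, N₂]` plus the boundary terms `N₂ < m ≤ x/d`, whence
`|…| ≤ A B W D₁ N₂ + A B (D₂ − D₁)(⌊x/D₁⌋ − N₂)` for `|a| ≤ A`, `|b| ≤ B`, `|lam| ≤ 1`.
[folklore; Friedlander–Iwaniec 1998 §26] -/
theorem abs_shortInterval_le (hII : ∀ D₁ D₂ N : ℕ, U ≤ D₁ → D₁ ≤ D₂ → D₂ ≤ 2 * D₁ → U / 2 ≤ N →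
      ∀ A B : ℝ, 0 ≤ A → 0 ≤ B → ∀ a b : ℕ → ℝ,
        (∀ d ∈ Ioc D₁ D₂, |a d| ≤ A) → (∀ m ∈ Ioc 0 N, |b m| ≤ B) →
        |∑ d ∈ Ioc D₁ D₂, a d * ∑ m ∈ Ioc 0 N, b m * lam (d * m)| ≤ A * B * W * D₁ * N) {x D₁ D₂ : ℕ} (hUD : U ≤ D₁) (hD₁ : 0 < D₁)
    (hD : D₁ ≤ D₂) (hD2 : D₂ ≤ 2 * D₁) (hD₂x : D₂ ≤ x) (hV : U / 2 ≤ x / D₂)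
    {A B : ℝ} (hA : 0 ≤ A) (hB : 0 ≤ B)
    (a b : ℕ → ℝ) (ha : ∀ d, d ≤ x → |a d| ≤ A) (hb : ∀ m, m ≤ x → |b m| ≤ B)
    (hlam : ∀ n, |lam n| ≤ 1) :
    |∑ d ∈ Ioc D₁ D₂, a d * ∑ m ∈ Ioc 0 (x / d), b m * lam (d * m)| ≤
      A * B * W * D₁ * (x / D₂ : ℕ) +
        A * B * ((D₂ - D₁ : ℕ) : ℝ) * ((x / D₁ - x / D₂ : ℕ) : ℝ) := by
  set N₂ := x / D₂ with hN₂
  have hD₂ : 0 < D₂ := lt_of_lt_of_le hD₁ hD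
  -- split the inner sums at `N₂`
  have hinner : ∀ d ∈ Ioc D₁ D₂, ∑ m ∈ Ioc 0 (x / d), b m * lam (d * m) =
      ∑ m ∈ Ioc 0 N₂, b m * lam (d * m) + ∑ m ∈ Ioc N₂ (x / d), b m * lam (d * m) := by
    intro d hd
    rw [mem_Ioc] at hd
    exact (sum_Ioc_consecutive _ (Nat.zero_le N₂) (Nat.div_le_div_left hd.2 (by omega))).symm
  rw [sum_congr rfl fun d hd => by rw [hinner d hd, mul_add], sum_add_distrib]
  refine (abs_add_le _ _).trans (add_le_add ?_ ?_)
  · -- the rectangle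
    have hN₂x : N₂ ≤ x := Nat.div_le_self x D₂
    exact hII D₁ D₂ N₂ hUD hD hD2 hV A B hA hB a b
      (fun d hd => ha d ((mem_Ioc.1 hd).2.trans hD₂x))
      (fun m hm => hb m ((mem_Ioc.1 hm).2.trans hN₂x))
  · -- the boundary terms
    calc |∑ d ∈ Ioc D₁ D₂, a d * ∑ m ∈ Ioc N₂ (x / d), b m * lam (d * m)|
        ≤ ∑ d ∈ Ioc D₁ D₂, A * ∑ m ∈ Ioc N₂ (x / d), B * 1 := by
          refine (abs_sum_le_sum_abs _ _).trans (sum_le_sum fun d hd => ?_)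
          rw [mem_Ioc] at hd
          rw [abs_mul]
          refine mul_le_mul (ha d (hd.2.trans hD₂x))
            ((abs_sum_le_sum_abs _ _).trans (sum_le_sum fun m hm => ?_)) (abs_nonneg _) hA
          rw [mem_Ioc] at hm
          rw [abs_mul]
          have hdm : d * m ≤ x := (Nat.mul_le_mul_left d hm.2).trans (Nat.mul_div_le x d)
          refine mul_le_mul (hb m ?_) (hlam _) (abs_nonneg _) hB
          exact le_trans (Nat.le_mul_of_pos_left m (by omega)) hdm
      _ ≤ ∑ d ∈ Ioc D₁ D₂, A * (((x / D₁ - x / D₂ : ℕ) : ℝ) * (B * 1)) := by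
          refine sum_le_sum fun d hd => mul_le_mul_of_nonneg_left ?_ hA
          rw [mem_Ioc] at hd
          rw [sum_const, nsmul_eq_mul, Nat.card_Ioc]
          have h2 : ((x / d - N₂ : ℕ) : ℝ) ≤ ((x / D₁ - x / D₂ : ℕ) : ℝ) := by
            have h1 : x / d ≤ x / D₁ := Nat.div_le_div_left (by omega) hD₁
            exact_mod_cast (by omega : x / d - N₂ ≤ x / D₁ - x / D₂)
          exact mul_le_mul_of_nonneg_right h2 (by rw [mul_one]; exact hB)
      _ = A * B * ((D₂ - D₁ : ℕ) : ℝ) * ((x / D₁ - x / D₂ : ℕ) : ℝ) := by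
          rw [sum_const, nsmul_eq_mul, Nat.card_Ioc]; ring

/-- **The block estimate**: for `U ≤ D`, `0 < D`, `DU ≤ x`, `2D ≤ x`, `1 ≤ K`, coefficients `|a| ≤ A`,
`|b| ≤ B` on `[1, x]` and `|lam| ≤ 1`,
`|∑_{D < d ≤ 2D} a(d) ∑_{m ≤ x/d} b(m) lam(dm)| ≤ K · A B W x + A B (D/K + 1)(x/D)`
(the block is cut into `K` short intervals: rectangles by the type-II hypothesis, boundary strips trivially — their
widths telescope). [folklore; Friedlander–Iwaniec 1998 §26] -/
theorem abs_block_le (hII : ∀ D₁ D₂ N : ℕ, U ≤ D₁ → D₁ ≤ D₂ → D₂ ≤ 2 * D₁ → U / 2 ≤ N →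
      ∀ A B : ℝ, 0 ≤ A → 0 ≤ B → ∀ a b : ℕ → ℝ,
        (∀ d ∈ Ioc D₁ D₂, |a d| ≤ A) → (∀ m ∈ Ioc 0 N, |b m| ≤ B) →
        |∑ d ∈ Ioc D₁ D₂, a d * ∑ m ∈ Ioc 0 N, b m * lam (d * m)| ≤ A * B * W * D₁ * N) (hW : 0 ≤ W) {x D K : ℕ} (hUD : U ≤ D) (hD : 0 < D)
    (hDU : D * U ≤ x) (h2D : 2 * D ≤ x) (hK : 0 < K) {A B : ℝ} (hA : 0 ≤ A) (hB : 0 ≤ B)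
    (a b : ℕ → ℝ) (ha : ∀ d, d ≤ x → |a d| ≤ A) (hb : ∀ m, m ≤ x → |b m| ≤ B)
    (hlam : ∀ n, |lam n| ≤ 1) :
    |∑ d ∈ Ioc D (2 * D), a d * ∑ m ∈ Ioc 0 (x / d), b m * lam (d * m)| ≤
      K * (A * B * W * x) + A * B * (((D / K + 1 : ℕ) : ℝ) * ((x / D : ℕ) : ℝ)) := by
  -- the cut points
  set E : ℕ → ℕ := fun i => D + i * D / K with hE
  have hEmono : Monotone E := fun i j hij => by
    simp only [hE]; exact Nat.add_le_add_left (Nat.div_le_div_right (Nat.mul_le_mul_right D hij)) D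
  have hE0 : E 0 = D := by simp [hE]
  have hEK : E K = 2 * D := by simp only [hE]; rw [Nat.mul_div_cancel_left D hK]; ring
  have hEge : ∀ i, D ≤ E i := fun i => Nat.le_add_right D _
  have hEle : ∀ i, i ≤ K → E i ≤ 2 * D := fun i hi => by rw [← hEK]; exact hEmono hi
  have hstep : ∀ i, E (i + 1) - E i ≤ D / K + 1 := by
    intro i
    simp only [hE]
    have : (i * D + D) / K ≤ i * D / K + D / K + 1 := by
      rw [Nat.add_div hK]; split_ifs <;> omega
    rw [show (i + 1) * D = i * D + D by ring]
    generalize (i * D + D) / K = p at this ⊢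
    generalize i * D / K = q at this ⊢
    generalize D / K = s at this ⊢
    omega
  have hsum : ∑ d ∈ Ioc D (2 * D), a d * ∑ m ∈ Ioc 0 (x / d), b m * lam (d * m) =
      ∑ i ∈ range K, ∑ d ∈ Ioc (E i) (E (i + 1)), a d * ∑ m ∈ Ioc 0 (x / d), b m * lam (d * m) := by
    rw [← Literature.NumberTheory.Sieve.FriedlanderIwaniecPrimes.PrimeSumEngine.sum_Ioc_eq_sum_range_pieces
      _ hEmono K, hE0, hEK]
  rw [hsum]
  -- `U/2 ≤ x/(2D) ≤ x/E(i+1)`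
  have hV2D : U / 2 ≤ x / (2 * D) := by
    rw [Nat.le_div_iff_mul_le (by omega)]
    calc U / 2 * (2 * D) = (U / 2 * 2) * D := by ring
      _ ≤ U * D := Nat.mul_le_mul_right D (Nat.div_mul_le_self U 2)
      _ = D * U := mul_comm _ _
      _ ≤ x := hDU
  have hpiece : ∀ i ∈ range K, |∑ d ∈ Ioc (E i) (E (i + 1)), a d * ∑ m ∈ Ioc 0 (x / d), b m * lam (d * m)| ≤
      A * B * W * x + A * B * ((D / K + 1 : ℕ) : ℝ) * (((x / E i : ℕ) : ℝ) - ((x / E (i + 1) : ℕ) : ℝ)) := by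
    intro i hi
    rw [mem_range] at hi
    have hD₁ : 0 < E i := lt_of_lt_of_le hD (hEge i)
    have hUD₁ : U ≤ E i := hUD.trans (hEge i)
    have hD₂ : E (i + 1) ≤ 2 * D := hEle (i + 1) hi
    have hD₂x : E (i + 1) ≤ x := hD₂.trans h2D
    have hD12 : E (i + 1) ≤ 2 * E i := hD₂.trans (Nat.mul_le_mul_left 2 (hEge i))
    have hV : U / 2 ≤ x / E (i + 1) :=
      hV2D.trans (Nat.div_le_div_left hD₂ (lt_of_lt_of_le hD (hEge (i + 1))))
    refine (abs_shortInterval_le hII hUD₁ hD₁ (hEmono (Nat.le_succ i)) hD12 hD₂x hV hA hB a b ha hb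
      hlam).trans (add_le_add ?_ ?_)
    · -- main term: `E i · (x / E(i+1)) ≤ x`
      have h1 : (E i : ℝ) * ((x / E (i + 1) : ℕ) : ℝ) ≤ x := by
        have : E i * (x / E (i + 1)) ≤ x :=
          (Nat.mul_le_mul_right _ (hEmono (Nat.le_succ i))).trans (Nat.mul_div_le x (E (i + 1)))
        exact_mod_cast this
      have h0 : 0 ≤ A * B * W := by positivity
      calc A * B * W * (E i : ℝ) * ((x / E (i + 1) : ℕ) : ℝ) = A * B * W * ((E i : ℝ) * ((x / E (i + 1) : ℕ) : ℝ)) := by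
            ring
        _ ≤ A * B * W * x := mul_le_mul_of_nonneg_left h1 h0
    · -- boundary term
      have hsub : ((E (i + 1) - E i : ℕ) : ℝ) ≤ ((D / K + 1 : ℕ) : ℝ) := by exact_mod_cast hstep i
      have hmono : x / E (i + 1) ≤ x / E i := Nat.div_le_div_left (hEmono (Nat.le_succ i)) hD₁
      have hdiff : ((x / E i - x / E (i + 1) : ℕ) : ℝ) = ((x / E i : ℕ) : ℝ) - ((x / E (i + 1) : ℕ) : ℝ) := by
        rw [Nat.cast_sub hmono]
      rw [hdiff]
      have hnn : (0 : ℝ) ≤ ((x / E i : ℕ) : ℝ) - ((x / E (i + 1) : ℕ) : ℝ) := by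
        rw [sub_nonneg]; exact_mod_cast hmono
      exact mul_le_mul_of_nonneg_right (mul_le_mul_of_nonneg_left hsub (by positivity)) hnn
  refine (abs_sum_le_sum_abs _ _).trans ((sum_le_sum hpiece).trans ?_)
  rw [sum_add_distrib, sum_const, card_range, nsmul_eq_mul, ← mul_sum,
    Finset.sum_range_sub' (fun i => ((x / E i : ℕ) : ℝ)) K, hE0, hEK]
  refine add_le_add le_rfl ?_
  rw [mul_assoc (A * B)]
  refine mul_le_mul_of_nonneg_left ?_ (by positivity)
  refine mul_le_mul_of_nonneg_left ?_ (by positivity)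
  have : (0 : ℝ) ≤ ((x / (2 * D) : ℕ) : ℝ) := Nat.cast_nonneg _
  linarith

end TypeII

end Summit.Parity.GeneralizedHardyLittlewood.Theorems.TypeIIToLevel

end
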